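import Mathlib
import HarnessLib
import HarnessLib.Audit
import Summits.HodgeConjecture.HodgeConjecture.Statement
import Literature.AlgebraicGeometry.HodgeTheory.GysinFormalism
import Literature.AlgebraicTopology.SingularHomology.CupProduct

/-!
Route: OG6ThetaCharacters

CLOSED (closed)  by . The file is kept as the record of this route; refuted decls are indexed as negative knowledge (`ledger negatives`).

# Route OG6ThetaCharacters — character projectors of the rigid group (Z/2)^8 cut HC(OG6-type) into
an invariant sector, even strings and chiral middle planes

Route OG6ThetaCharacters realises idea card og6-theta-characteristics-chiral-cycles (spine). It
suffices to show X = `Target`: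
the Hodge conjecture `HodgeConjectureFor 6 X` for every OG6 FRAME — a smooth projective sixfold X
over ℂ with a Hodge model,
b₁ = b₃ = b₅ = 0, b₂ = 8, b₄ = 199, b₆ = 1504, H^(2,0) = ℂσ with σ³ ≠ 0 in H⁶, and a faithful action
g : (Z/2)^8 → Aut(X) that is
trivial on H²(X(ℂ);ℂ) — which is ENDOMORPHISM-GENERIC (E = Q: every rational Hodge endomorphism of
H² acts on σ by a rational scalar).
By Mongardi–Wandel (arXiv:1411.0759 Thm 4.2: Aut₀ = ker(Aut X → O(H²)) ≅ (Z/2)^8 for every OG6-type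
manifold), Hassett–Tschinkel
deformation invariance (arXiv:1004.0046 Thm 2.1) and the MRS Betti numbers (arXiv:1603.06731), every
projective manifold of OG6 type is
such a frame (informal support item FrameOfOG6Type; the deformation type itself is a definition
request), so X is "HC for
endomorphism-generic projective OG6-type manifolds" — a locally complete hyper-Kähler family on
which HC is open in general (for the
other sporadic-group sixfolds, Kum³-type, it is a theorem: arXiv:2308.02267; for OG6 it is known
only on the singular-OG6 divisor
arXiv:2504.13607 and the modular locus arXiv:2203.16257 Cor 2).
X splits along the algebraic character projectors e_a = 2⁻⁸ Σ_b (−1)^(a·b) g_b^* (ℚ-combinations of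
graphs of automorphisms) into
X₀ = InvariantSector (a = 0, all degrees), X_even = EvenCharacterStrings (characters occurring on
H⁴: degrees 4, 6, 8) and
X_odd = ChiralThreefolds (characters absent from H⁴: degrees 6, 8); FourierInversion (Σ_a e_a = id)
and OuterDegrees glue them.
Lean: `∀ (X : Literature.AlgebraicGeometry.Motives.SchemeOver ℂ) (g : (Fin 8 → ZMod 2) → (X ⟶ X)),
(Literature.AlgebraicGeometry.Motives.IsSmoothProjective 6 X ∧ Nonempty
(Literature.AlgebraicGeometry.HodgeTheory.HodgeModel 6 X) ∧ (Subsingleton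
(Literature.AlgebraicGeometry.HodgeTheory.complexBetti X 1) ∧ Subsingleton
(Literature.AlgebraicGeometry.HodgeTheory.complexBetti X 3) ∧ Subsingleton
(Literature.AlgebraicGeometry.HodgeTheory.complexBetti X 5)) ∧ (Module.finrank ℂ
(Literature.AlgebraicGeometry.HodgeTheory.complexBetti X 2) = 8 ∧ Module.finrank ℂ
(Literature.AlgebraicGeometry.HodgeTheory.complexBetti X 4) = 199 ∧ Module.finrank ℂ
(Literature.AlgebraicGeometry.HodgeTheory.complexBetti X 6) = 1504) ∧ (∃ σ :
Literature.AlgebraicGeometry.HodgeTheory.complexBetti X 2,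
Literature.AlgebraicGeometry.HodgeTheory.IsOfHodgeType 6 X 2 2 0 σ ∧
Literature.AlgebraicTopology.SingularHomology.cupProduct (show 2 + 4 = 6 from rfl) σ
(Literature.AlgebraicTopology.SingularHomology.cupProduct (show 2 + 2 = 4 from rfl) σ σ) ≠ 0 ∧ ∀ τ :
Literature.AlgebraicGeometry.HodgeTheory.complexBetti X 2,
Literature.AlgebraicGeometry.HodgeTheory.IsOfHodgeType 6 X 2 2 0 τ → ∃ t : ℂ, τ = t • σ) ∧ (g 0 =
CategoryTheory.CategoryStruct.id X ∧ (∀ a b : (Fin 8 → ZMod 2), g (a + b) =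
CategoryTheory.CategoryStruct.comp (g a) (g b)) ∧ (∀ a : (Fin 8 → ZMod 2), a ≠ 0 → g a ≠
CategoryTheory.CategoryStruct.id X) ∧ (∀ (a : (Fin 8 → ZMod 2)) (c :
Literature.AlgebraicGeometry.HodgeTheory.complexBetti X 2),
Literature.AlgebraicGeometry.HodgeTheory.complexBetti.map (g a) 2 c = c))) → (∀ ψ :
Literature.AlgebraicGeometry.HodgeTheory.complexBetti X 2 →ₗ[ℂ]
Literature.AlgebraicGeometry.HodgeTheory.complexBetti X 2, (∀ c,
Literature.AlgebraicGeometry.HodgeTheory.IsRationalClass c →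
Literature.AlgebraicGeometry.HodgeTheory.IsRationalClass (ψ c)) → (∀ (p q : ℕ) (c :
Literature.AlgebraicGeometry.HodgeTheory.complexBetti X 2),
Literature.AlgebraicGeometry.HodgeTheory.IsOfHodgeType 6 X 2 p q c →
Literature.AlgebraicGeometry.HodgeTheory.IsOfHodgeType 6 X 2 p q (ψ c)) → ∃ r : ℚ, ∀ σ :
Literature.AlgebraicGeometry.HodgeTheory.complexBetti X 2,
Literature.AlgebraicGeometry.HodgeTheory.IsOfHodgeType 6 X 2 2 0 σ → ψ σ = (r : ℂ) • σ) →
Literature.AlgebraicGeometry.HodgeTheory.HodgeConjectureFor 6 X`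

## Assembly
Pure logic plus `Submodule.sum_mem`: given an endomorphism-generic frame and a rational (p,p)-class
c, FourierInversion rewrites
c = Σ_a e_a c; the a = 0 term is algebraic by InvariantSector; for a ≠ 0 and p ∈ {2,3,4} split on
whether the character of a occurs on
H⁴: if not, p = 2 gives e_a c = 0 and p = 3, 4 are ChiralThreefolds; if it does,
EvenCharacterStrings; p ∉ {2,3,4} is OuterDegrees;
the Hodge-model conjunct of `HodgeConjectureFor` is a frame hypothesis. PROVED sorry-free in the
planner's Sketch.lean
(`assembly_holds`, axioms propext/Classical.choice/Quot.sound; lean check rc 0, 2026-08-15). The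
route is a regime route: the Assembly
ends at `Target`, and `TargetOfHodgeConjecture : HodgeConjecture → Target` records the relation to
the summit.

Rationale: WHY THIS LINE. Mechanism (card og6-theta-characteristics-chiral-cycles): the rigid group G = Aut₀(X)
≅ (Z/2)^8 of an OG6-type manifold (arXiv:1411.0759
Thm 4.2) deforms with X (arXiv:1004.0046 Thm 2.1), commutes with the LLV algebra so(4,6)
(arXiv:1906.03432 Thm 52: H* = V_(3) ⊕ V_(1,1,1)
⊕ 135 V ⊕ 240 ℝ), and its 256 character projectors are FREE algebraic self-correspondences; they cut
every Hodge class into pieces that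
are separately Hodge, so HC(X) is literally the conjunction of sector statements, and in the
non-trivial sectors — which carry the 135
canonical classes of H⁴ and the 240 canonical middle classes (type (3,3), Λ_h- and L_h-trivial,
never effective by Verbitsky
doi:10.1007/bf01928217) — HC becomes a SPANNING statement "some cycle Z has e_a[Z] ≠ 0", certifiable
by intersection numbers on one model
because fixed loci and G-orbits of cycles deform with X. Imported from finite-group representation
theory (character projectors, Lefschetz
trace bookkeeping: Σ_g χ(X^g) = 256·dim(H*)^G) and hyper-Kähler geometry (LLV decomposition,
trianalytic parity, hyperholomorphic transport
arXiv:1805.11574 as fallback engine); the template is Floccari's proof of HC for Kum³-type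
(arXiv:2308.02267: G = (Z/2)^5, invariant part
via the associated K3 surface, canonical classes via fixed fourfolds W_τ and the classes d_τ,α =
ι_*(divisors), Prop 6.1/6.5) and
Hassett–Tschinkel's Kum² (arXiv:1004.0046), transplanted to OG6 where the published fixed-locus
record (arXiv:1411.0759 Props 5.1, 5.3,
5.7: 16 K3 / 2 K3 / 16 points) is provably INCONSISTENT with Lefschetz (Σ_(g≠1) χ(X^g) = 16560 <
51840 = 256·210 − 1920 forced by the
G-invariant 210-dimensional Verbitsky subalgebra), so the decisive census (do fixed FOURFOLDS
exist?) is genuinely open. No prior route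
of this summit touches OG6 (EvenB2Twistor, LimitExtension mention it only as out of scope);
negatives index empty.

RANKED CRUXES. #0 Target (target) — X: for every OG6 frame (X, g) as in § Thesis which is
endomorphism-generic (E = Q), HodgeConjectureFor 6 X. Equivalent, via the informal support item
FrameOfOG6Type, to HC for endomorphism-generic projective manifolds of OG6 type. (why it might fail:
False iff some endomorphism-generic projective OG6 frame carries a non-algebraic Hodge class
(motivated and absolute by arXiv:1904.11320, so ¬B would follow); HC(OG6) is known only on the
singular-OG6 divisor (arXiv:2504.13607) and modular locus (arXiv:2203.16257).) [arXiv:2504.13607,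
arXiv:2203.16257, arXiv:2308.02267, arXiv:1411.0759, Deligne2000]
#2 ChiralThreefolds (crux) — CHIRAL MIDDLE PLANES (card C1): for every OG6 frame (X, g), every a ≠ 0
whose character does NOT occur on H⁴ (∀ c₄, e_a c₄ = 0 — the card's 120 "odd theta characteristics",
carrying the 240 canonical LLV-singlets two at a time) and every rational (3,3)-class c ∈ H⁶ (resp.
(4,4)-class in H⁸), the projection e_a c = 2⁻⁸ Σ_b (−1)^(a·b) g_b^* c is algebraic. Equivalently: on
every projective OG6-type X there are algebraic 3-cycles whose e_a-projections span e_a H⁶ (chiral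
threefolds); the H⁸ clause is Poincaré-dual bookkeeping. [difficulty: XL] (why it might fail: If no
involution in G fixes a fourfold (arXiv:1411.0759 §5 records only K3s and points), no fixed-locus
cycle reaches H⁶; these classes are never effective (Verbitsky) nor reachable by L_h, Λ_h, so off
the singular-OG6 divisor only untested G-equivariant hyperholomorphic transport remains.)
[arXiv:1906.03432, arXiv:1411.0759, arXiv:2308.02267, arXiv:2504.13607, doi:10.1007/bf01928217,
arXiv:1805.11574]
#3 EvenCharacterStrings (crux) — EVEN CHARACTER STRINGS (card C2): for every OG6 frame (X, g) and
every a ≠ 0 whose character OCCURS on H⁴ (∃ c₄, e_a c₄ ≠ 0 — the card's 135 non-zero "even theta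
characteristics", one canonical line u_a ∈ H⁴ each, with the V-string u_a·H² ⊂ H⁶ and u_a·h² ∈ H⁸),
the e_a-projections of rational (2,2)-, (3,3)- and (4,4)-classes are algebraic. Intended proof: e_a
H⁸ is spanned by e_a[S] for the fixed K3 surfaces S of the 30 pure involutions (arXiv:1411.0759
Props 5.1, 5.3; fixed loci deform with X), then invert L_h² (standard conjecture B for OG6-type in
degrees 4 ↔ 8) or use fixed fourfolds if the census finds them; H⁶ follows by cup with divisors.
[difficulty: L] (why it might fail: Fixed K3 surfaces feed only H⁸; reaching the H⁴ lines needs a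
Lefschetz inversion (standard conjecture B for OG6-type, open off the modular locus) or fixed
fourfolds; and the 16-K3 configurations of the 30 pure involutions may span only the characters of a
proper subgroup.) [arXiv:1411.0759, arXiv:1009.0413, arXiv:1906.03432, arXiv:2203.16257,
arXiv:1004.0046]
#4 InvariantSector (crux) — INVARIANT SECTOR (card "A₂-part" made honest): for every
endomorphism-generic OG6 frame (X, g) (E = Q) and every rational (p,p)-class c, the G-average e₀ c =
2⁻⁸ Σ_b g_b^* c is algebraic. By the card's character table (H*)^G = V_(3) ⊕ V_(1,1,1): for E = Q
its Hodge classes are polynomials in NS(X) and the Beauville–Bogomolov class q^∨ (= c₂(X)/c if c₂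
has no U₄-component) plus the V_(1,1,1)-classes h∧u₊∧u₋ (ρ ≥ 1), d∧d′ ∈ Λ²NS ⊂ H⁴, H⁸ (ρ ≥ 2), Λ³NS
(ρ ≥ 3) and det T ∈ Λ³T ⊂ H⁶ (ρ = 5). Natural engines: the associated K3^[3]-type double cover on
the singular-OG6 divisor (arXiv:2504.13607, arXiv:1603.06731), quotients X/H for H ≤ G (Floccari's
Y_K for Kum³, arXiv:2210.02948), deformation of these classes from the modular locus
(arXiv:2203.16257). [difficulty: L] (why it might fail: If the character table puts a trivial
character inside the 135 V-copies or the 240 singlets this sector contains canonical exceptional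
classes; even otherwise the V_(1,1,1) classes (h∧u₊∧u₋, d∧d′, det T for ρ = 5 — killed by every L_d
and Λ_d) have no known cycles off the singular-OG6 divisor.) [arXiv:1906.03432, arXiv:2203.16257,
arXiv:2504.13607, arXiv:2210.02948, arXiv:2308.02267]
#9 OuterDegrees (support) — BOOKKEEPING: for an OG6 frame, p ∉ {2,3,4} and a ≠ 0, the e_a-projection
of a rational (p,p)-class in H^(2p) is algebraic — indeed it vanishes: H⁰ and H² are G-trivial by
hypothesis (and algebraicClasses X 0 = ⊤ is proved), H¹⁰, H¹² by hard Lefschetz with a G-invariant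
ample class / Poincaré duality and naturality of cup product (`cupProduct_map`, proved), H^(2p) = 0
for p ≥ 7 (cohomological dimension of the 12-manifold X(ℂ)); needs the named facts hard Lefschetz /
top-degree vanishing for X. [difficulty: provable-now] [arXiv:1411.0759, Deligne2000]
#9 FourierInversion (support) — CHARACTER ORTHOGONALITY: for an OG6 frame, Σ_a e_a c = c on every
H^k — from g 0 = 𝟙, `complexBetti.map_id` (proved) and Σ_a (−1)^(a·b) = 256·[b = 0] on (Fin 8 → ZMod
2) (factorise over coordinates). Pure algebra. [difficulty: provable-now] [arXiv:1411.0759]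
#9 TargetOfHodgeConjecture (support) — FRAME: the summit statement implies X (OG6 frames are smooth
projective sixfolds) — records that X is an instance family of `HodgeConjecture`. PROVED in the
planner's Sketch.lean (`targetOfHodgeConjecture_holds`, one line). [difficulty: provable-now]
[Deligne2000]

TWO-LAYER PLAN. Foreseen glued splits (filed only after the informal support item CharacterCensus
settles the character table and the fixed loci):
ChiralThreefolds ⇐ FixedFourfoldCycles (if some involutions fix HK fourfolds W: the classes e_a
ι_*(Pic W), which stay analytic on every
deformation by Floccari's Lemma 6.4 argument, span e_a H⁶ for every odd a — a finite
intersection-number certificate on one model) →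
ChiralThreefolds; otherwise ChiralThreefolds ⇐ DivisorAnchor (HC on crepant resolutions of singular
OG6-varieties, arXiv:2504.13607 —
known) → EquivariantHyperholomorphicTransport (a G-orbit of slope-polystable hyperholomorphic
reflexive sheaves on an anchor X₀ whose ch₃
has full odd-character support deforms along twistor paths to every OG6-type manifold,
arXiv:1805.11574 §-style) → ChiralThreefolds.
EvenCharacterStrings ⇐ FixedK3SpanU8 (e_a[S], S the 16-K3 fixed loci of the 30 pure involutions,
span e_a H⁸ for all even a ≠ 0) →
LefschetzInversionOG6 (L_h² : e_a H⁴ → e_a H⁸ has an algebraic inverse correspondence: standard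
conjecture B for OG6-type in degrees
4 ↔ 8, Charles–Markman style arXiv:1009.0413) → EvenCharacterStrings. InvariantSector ⇐
BeauvilleBogomolovClass (q^∨ algebraic:
c₂(X) = c·q^∨ + G-invariant U₄-part) → WedgeClasses (the V_(1,1,1) Hodge classes for E = Q) →
InvariantSector, the glue being SO(T)-invariant
theory of V_(3) ⊕ V_(1,1,1). k ≤ 3 children each, depth 1.

KILL CRITERIA. A refutation of ChiralThreefolds, EvenCharacterStrings or InvariantSector is a
projective OG6-type X with a non-algebraic rational
(p,p)-class, i.e. a COUNTEREXAMPLE TO THE HODGE CONJECTURE (and, the classes being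
motivated/absolute by arXiv:1904.11320, to standard
conjecture B): close `refuted:<Decl>` and hand the witness to the summit's negative side. Pivots:
(i) CharacterCensus finds a trivial
character among the 240 singlets or the 135 V-copies ⇒ canonical classes migrate into
InvariantSector — re-rank InvariantSector to 2 and
restate the sector split (no statement becomes false); (ii) CharacterCensus confirms that no
involution fixes a fourfold AND a
Voisin-type vanishing "every G-equivariant hyperholomorphic sheaf on a very general OG6 has ch₃ with
zero odd-character component" is
proved ⇒ ChiralThreefolds has no engine left: route dormant, card re-graded. Mooted if HC(OG6-type)
is proved wholesale elsewhere (e.g.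
an extension of arXiv:2504.13607 off the singular-OG6 divisor by Markman-type transport).

NOT DECOMPOSED YET. Deliberately not itemised at open: the E ≠ Q sector (real or complex
multiplication on T(X), rk T ≤ 7: the K3-type exceptional classes in
Sym² T ⊂ H⁴ — a different mechanism, cf. route EvenB2Twistor; Target and InvariantSector carry the E
= Q hypothesis explicitly); the
character table and fixed-locus census of G on OG6 (informal support item CharacterCensus: a finite
computation on the
Mongardi–Rapagnetta–Saccà model, prerequisite for every layer-2 split); the hyper-Kähler layer
(twistor families, slope-stability,
hyperholomorphic sheaves, trianalytic subvarieties — untyped in Literature;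
EquivariantHyperholomorphicTransport stays prose until then);
the identification of the typed frame with the deformation type (FrameOfOG6Type, informal;
definition request IsOfOGradySixType);
Chow-level and Tate-side statements (arXiv:2009.10959) and Kum_n, n ≥ 4 (same template, recorded on
the card, not pursued).

CHEAPEST FALSIFIER. The CHARACTER CENSUS on one model (refuters/grounders first; kit-sized
bookkeeping, no periods): from Floccari's motivic decomposition of the
modular OG6 h(K̃_v) = h(Km(A)^(3)) ⊕ h(Km(A)²)(−1) ⊕ h(Km(A×A))(−1) ⊕ 137 h(Km A)(−2) ⊕ 512 Q(−3)
(arXiv:2203.16257 Thm 1) and the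
(A×A^)[2]-action traced through the MRS construction, compute tr(g^*|H⁴), tr(g^*|H⁶) for the 255
involutions and the fixed loci
(redoing arXiv:1411.0759 Prop 5.7, which contradicts Σ_g χ(X^g) = 256·dim(H*)^G ≥ 256·210: 1920 +
30·384 + 45·48 + 180·16 = 18480 is not
even divisible by 256). KILLS the line's engines if: the 240 LLV-singlets contain G-invariants of
large multiplicity (projectors do not
separate canonical classes) — the typed cruxes stay true-or-HC-false but lose their point; CONFIRMS
the fast lane if some involutions fix
fourfolds (then Floccari's Kum³ proof ports). I could not run it here (no OG6 model in kit; it is a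
pen-and-paper/representation-theory
computation): filed as CharacterCensus. Lookup already done: HC(OG6-type) is NOT in print beyond the
singular-OG6 divisor
(arXiv:2504.13607, 2026) — zbMATH/arXiv-local searches 2026-08-15.

NUMBERS. OG6-type: b₂ = 8, b₄ = 199, b₆ = 1504, χ_top = 1920, no odd cohomology (arXiv:1603.06731);
LLV: H* = V_(3) (210) ⊕ V_(1,1,1) (120 =
28 + 64 + 28 in degrees 4, 6, 8) ⊕ 135 V (135 + 1080 + 135) ⊕ 240 ℝ (degree 6) (arXiv:1906.03432 Thm
52, Lemma 59); canonical Hodge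
classes: 1 + 135 in H⁴, 240 in H⁶, 136 in H⁸. |G| = 256, 255 involutions = 30 pure (fixed locus 16
K3, χ = 384: Props 5.1/5.3) + 225
mixed (Prop 5.7 claims 45 × 2 K3 + 180 × 16 points; Lefschetz needs their χ to average ≥ 179.2; the
card's theta-characteristic table
predicts 105 × 384 + 120 × 256, dim(H*)^G = 330, (H⁴)^G = 64, (H⁶)^G = 184). Kum³ comparison
(arXiv:2308.02267): G = (Z/2)^5, χ(K^g) ∈
{464, 192}, fixed K3^[2]-fourfolds W_τ + 140 points, 240 singlets with no G-invariants, 256 classes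
d_τ,α spanning the 241 canonical
middle classes. Moduli: polarized OG6-type families are 5-dimensional; HC known on the 4-dimensional
singular-OG6 divisors
(arXiv:2504.13607) and the 3-dimensional modular loci (arXiv:2203.16257). Items at open: 8 typed + 2
informal support.

DEFINITION REQUESTS. IsOfOGradySixType (X deformation equivalent, through smooth proper families, to
O'Grady's crepant resolution K̃_v(A,H) of the Albanese
fibre of M_(2v₀)(A,H); topic Literature/AlgebraicGeometry/Hyperkaehler — none of hyper-Kähler
manifold, Beauville–Bogomolov form, LLV
algebra, Aut₀, trianalytic subvariety exists in Literature: `lean search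
'HyperKaehler|IrreducibleSymplectic|OGrady|Beauville' --decl` = 0
hits) — wanted to replace the inline frame and to type FrameOfOG6Type and CharacterCensus. Cite
facts wanted (family hodge): "fact:
Aut₀(OG6-type) ≅ (Z/2)^8" (arXiv:1411.0759 Thm 4.2), "fact: LLV decomposition of OG6-type"
(arXiv:1906.03432 Thm 52), "fact: HC for
crepant resolutions of singular OG6-varieties" (arXiv:2504.13607), "fact: Aut₀ is deformation
invariant" (arXiv:1004.0046 Thm 2.1).

Novelty: Searches (2026-08-15): `lit search "O'Grady six dimensional hyperkähler Hodge conjecture algebraic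
cycles"` (local 9: arXiv:2009.10959,
1904.11320, 2504.13607, 2308.02267, 1002.5011, 2602.19835 …; remote rate-limited except crossref 15
generic); zbMATH: "Hodge conjecture
O'Grady sixfold" (1: arXiv:2210.02948), "O'Grady six algebraic cycles Chow" (0), "OG6 type
hyper-Kähler" (8: arXiv:2204.09582,
1909.07173, 2109.03987, 2009.02120, 2407.07622 …), "O'Grady six dimensional automorphisms" (1:
arXiv:1603.06731), "Lefschetz standard
conjecture hyper-Kähler O'Grady" (0), "hyperholomorphic sheaves O'Grady" (2: arXiv:2211.08970,
arXiv:2504.13607), "motive O'Grady six"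
(2: arXiv:2009.10959, arXiv:2203.16257); `lit frontier HodgeConjecture --since 2021` (30 rows, none
on OG6; arXiv:2501.02315 Kum-type ↔
K3); `lit galaxy search "O'Grady six" / "of OG6 type" / "Hodge conjecture hyperkähler" --star all`
(0 relevant); READ: arXiv:1411.0759
§4–5 (Thm 4.2, Props 5.1/5.3/5.7, Rem 5.9), arXiv:1906.03432 §3.5 (Thm 52, Props 54/56/58, Lemma
59), arXiv:2203.16257 (Thm 1, Cor 2, §5),
arXiv:2308.02267 §1, §2.4–2.5, §6 (Prop 6.1, Lemma 6.4, Prop 6.5), arXiv:2504.13607 abstract + §1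
(Thm 1.3); negatives index (0).
Nearest prior art found: arXiv:2308.02267 (Floccari: HC for ALL projective Kum³-type by exactly this
template — Aut₀-subgroup (Z/2)^5,
invariant part via the associated K3 / quotient Y_K, 240 canonical middle classes via divisors on
fixed fourfolds, Lefschetz trace to
show the singlets have  [refs: 2009.10959, 2210.02948, 2204.09582, 1603.06731, 2211.08970, 2504.13607, 2203.16257, 2501.02315, 1411.0759, 1906.03432, 2308.02267, 1004.0046, 2308.04865]

Barriers (technique_class: hyperkaehler, finite-group-characters, trianalytic): - technique_class: hyperkaehler, finite-group-characters, trianalytic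
- Literature.Barriers.HodgeConjecture.Weil1977_exceptionalHodgeClasses: the 135 + 240 canonical
classes and the V_(1,1,1) wedge classes ARE exceptional (outside the divisor ring); the line never
claims divisor generation — it isolates them by algebraic projectors and routes each sector to a
named engine (fixed loci + Lefschetz inversion; fixed fourfolds or equivariant hyperholomorphic
transport; associated K3^[3] cover).
- Literature.Barriers.HodgeConjecture.Mumford1968_simpleFourfold_exceptionalHodgeClasses: same
answer; moreover the E = Q hypothesis of Target/InvariantSector excludes the CM/RM exceptional
classes in Sym² T, which are conceded (Not decomposed yet).
- Literature.Barriers.HodgeConjecture.Andre1996_hodgeClassesOnAbelianVarieties_motivated: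
consistent, not evaded — OG6 classes are motivated and absolute (arXiv:1904.11320), so the negative
branch of the kill criteria would contradict standard conjecture B; no Galois-conjugation test is
proposed.
- Literature.Barriers.HodgeConjecture.Voisin2002_weilTorus_hodgeClassWithoutSubvarieties: bites on
CARRIERS exactly as Verbitsky's parity does (no effective or coherent-sheaf-free carrier of a pure
singlet class on a very general OG6 is expected); the fallback engine transports SHEAVES of rank ≥ 2
along twistor lines through non-projective members and reads Chern classes at projective endpoints
by GAGA (Deligne2000 §2 (ii)), as in Markman arXiv:1805.115

Novelty grade: variant — ROUTE REVIEW (refuter rreview d2aef6b8, 2026-08-15): KEEP OPEN, no blocking objection. Typed cruxes 8119/8120/8121 and 8122 are HC-implied sector statements (e_a = 2⁻⁸Σ_b (−1)^{a·b} g_b^* preserves rationality and Hodge type): unrefutable short of ¬HC; split exhaustive by excluded middle on 'charact (refuter refuter-rreview-route-CriticalPhenomena--d2aef6b8-0, 2026-08-15T13:45:58Z; prior: arXiv:2308.02267, arXiv:1004.0046, arXiv:1411.0759, arXiv:1906.03432, arXiv:2504.13607)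

History (route lifecycle, newest last):
- 2026-08-15T12:31:31Z · rev 1: dropped TargetOfHodgeConjecture — dedup artefact: the frame signature 'HodgeConjecture → Target' collided with EvenB2Twistor item stmt-HodgeConjecture-3244 (a different Target decl); not load-be (planner-plancard-HodgeConjecture-HodgeConject-1ea43a5c-0)

sub-problem: HodgeConjecture · status: closed(closed) · opened planner-plancard-HodgeConjecture-HodgeConject-1ea43a5c-0 2026-08-15T12:28:39Z · rev 2 · ledger route-HodgeConjecture-OG6ThetaCharacters
GENERATED by the gate from the ledger (D-0016/17). Provers cite these decls: `theorem foo : Summit.HodgeConjecture.HodgeConjecture.Theses.OG6ThetaCharacters.<Decl> := …` in Summits/HodgeConjecture/HodgeConjecture/Theorems/<Name>.lean.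
-/

namespace Summit.HodgeConjecture.HodgeConjecture.Theses.OG6ThetaCharacters

open scoped BigOperators Topology Manifold Classical MeasureTheory ProbabilityTheory Matrix InnerProductSpace ComplexConjugate ContinuousMap
open Filter Set Function TopologicalSpace MeasureTheory

attribute [summit_statement] _root_.HodgeConjecture

/-- item stmt-HodgeConjecture-8118 · target · rank 0 · closed · moot by None · by planner
why it might fail: HC for endomorphism-generic projective OG6-type is open off the OG6-resolution divisor (2504.13607 Thm 1.4: 4-dim families in 5-dim moduli) and the modular locus (2203.16257 Cor 2); false iff such an X has a non-algebraic Hodge class — motivated/absolute by 1904.11320, so B would fall too.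
sources: arXiv:2504.13607, arXiv:2203.16257, arXiv:1904.11320, arXiv:2308.02267, arXiv:1411.0759, Deligne2000
[target] X: for every OG6 frame (X, g) as in § Thesis which is endomorphism-generic (E = Q),
HodgeConjectureFor 6 X. Equivalent, via the informal support item FrameOfOG6Type, to HC for
endomorphism-generic projective manifolds of OG6 type. -/
@[route_item "route-HodgeConjecture-OG6ThetaCharacters"]
def Target : Prop :=
  ∀ (X : Literature.AlgebraicGeometry.Motives.SchemeOver ℂ) (g : (Fin 8 → ZMod 2) → (X ⟶ X)), (Literature.AlgebraicGeometry.Motives.IsSmoothProjective 6 X ∧ Nonempty (Literature.AlgebraicGeometry.HodgeTheory.HodgeModel 6 X) ∧ (Subsingleton (Literature.AlgebraicGeometry.HodgeTheory.complexBetti X 1) ∧ Subsingleton (Literature.AlgebraicGeometry.HodgeTheory.complexBetti X 3) ∧ Subsingleton (Literature.AlgebraicGeometry.HodgeTheory.complexBetti X 5)) ∧ (Module.finrank ℂ (Literature.AlgebraicGeometry.HodgeTheory.complexBetti X 2) = 8 ∧ Module.finrank ℂ (Literature.AlgebraicGeometry.HodgeTheory.complexBetti X 4) = 199 ∧ Module.finrank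 ℂ (Literature.AlgebraicGeometry.HodgeTheory.complexBetti X 6) = 1504) ∧ (∃ σ : Literature.AlgebraicGeometry.HodgeTheory.complexBetti X 2, Literature.AlgebraicGeometry.HodgeTheory.IsOfHodgeType 6 X 2 2 0 σ ∧ Literature.AlgebraicTopology.SingularHomology.cupProduct (show 2 + 4 = 6 from rfl) σ (Literature.AlgebraicTopology.SingularHomology.cupProduct (show 2 + 2 = 4 from rfl) σ σ) ≠ 0 ∧ ∀ τ : Literature.AlgebraicGeometry.HodgeTheory.complexBetti X 2, Literature.AlgebraicGeometry.HodgeTheory.IsOfHodgeType 6 X 2 2 0 τ → ∃ t : ℂ, τ = t • σ) ∧ (g 0 = CategoryTheory.CategoryStruct.id X ∧ (∀ a b : (Fin 8 → ZMod 2), g (a + b) = CategoryTheory.CategoryStruct.comp (g a) (g b)) ∧ (∀ a : (Fin 8 → ZMod 2), a ≠ 0 → g a ≠ CategoryTheory.CategoryStruct.id X) ∧ (∀ (a : (Fin 8 → ZMod 2)) (c : Literature.AlgebraicGeometry.HodgeTheory.complexBetti X 2), Literature.AlgebraicGeometry.HodgeTheory.complexBetti.map (g a) 2 c = c))) → (∀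 ψ : Literature.AlgebraicGeometry.HodgeTheory.complexBetti X 2 →ₗ[ℂ] Literature.AlgebraicGeometry.HodgeTheory.complexBetti X 2, (∀ c, Literature.AlgebraicGeometry.HodgeTheory.IsRationalClass c → Literature.AlgebraicGeometry.HodgeTheory.IsRationalClass (ψ c)) → (∀ (p q : ℕ) (c : Literature.AlgebraicGeometry.HodgeTheory.complexBetti X 2), Literature.AlgebraicGeometry.HodgeTheory.IsOfHodgeType 6 X 2 p q c → Literature.AlgebraicGeometry.HodgeTheory.IsOfHodgeType 6 X 2 p q (ψ c)) → ∃ r : ℚ, ∀ σ : Literature.AlgebraicGeometry.HodgeTheory.complexBetti X 2, Literature.AlgebraicGeometry.HodgeTheory.IsOfHodgeType 6 X 2 2 0 σ → ψ σ = (r : ℂ) • σ) → Literature.AlgebraicGeometry.HodgeTheory.HodgeConjectureFor 6 X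

/-- item stmt-HodgeConjecture-8119 · crux · rank 2 · closed · moot by None · by planner
why it might fail: Published fixed loci (1411.0759 Props 5.1/5.3/5.7) give Σ_g χ(X^g)=18480, not 256·dim(H*)^G ≥ 256·210: census unreliable. If still no involution fixes a fourfold, no known cycle reaches these L_h/Λ_h-invisible, never-effective (Verbitsky) planes off the OG6-resolution divisor (2504.13607 Thm 1.4).
sources: arXiv:1411.0759, arXiv:1906.03432, arXiv:2504.13607, arXiv:2203.16257, doi:10.1007/bf01928217, arXiv:1805.11574
[crux] CHIRAL MIDDLE PLANES (card C1): for every OG6 frame (X, g), every a ≠ 0 whose character does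
NOT occur on H⁴ (∀ c₄, e_a c₄ = 0 — the card's 120 "odd theta characteristics", carrying the 240
canonical LLV-singlets two at a time) and every rational (3,3)-class c ∈ H⁶ (resp. (4,4)-class in
H⁸), the projection e_a c = 2⁻⁸ Σ_b (−1)^(a·b) g_b^* c is algebraic. Equivalently: on every
projective OG6-type X there are algebraic 3-cycles whose e_a-projections span e_a H⁶ (chiral
threefolds); the H⁸ clause is Poincaré-dual bookkeeping. [difficulty: XL] -/
@[route_item "route-HodgeConjecture-OG6ThetaCharacters"]
def ChiralThreefolds : Prop :=
  ∀ (X : Literature.AlgebraicGeometry.Motives.SchemeOver ℂ) (g : (Fin 8 → ZMod 2) → (X ⟶ X)), (Literature.AlgebraicGeometry.Motives.IsSmoothProjective 6 X ∧ Nonempty (Literature.AlgebraicGeometry.HodgeTheory.HodgeModel 6 X) ∧ (Subsingleton (Literature.AlgebraicGeometry.HodgeTheory.complexBetti X 1) ∧ Subsingleton (Literature.AlgebraicGeometry.HodgeTheory.complexBetti X 3) ∧ Subsingleton (Literature.AlgebraicGeometry.HodgeTheory.complexBetti X 5)) ∧ (Module.finrank ℂ (Literature.AlgebraicGeometry.HodgeTheory.complexBetti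 X 2) = 8 ∧ Module.finrank ℂ (Literature.AlgebraicGeometry.HodgeTheory.complexBetti X 4) = 199 ∧ Module.finrank ℂ (Literature.AlgebraicGeometry.HodgeTheory.complexBetti X 6) = 1504) ∧ (∃ σ : Literature.AlgebraicGeometry.HodgeTheory.complexBetti X 2, Literature.AlgebraicGeometry.HodgeTheory.IsOfHodgeType 6 X 2 2 0 σ ∧ Literature.AlgebraicTopology.SingularHomology.cupProduct (show 2 + 4 = 6 from rfl) σ (Literature.AlgebraicTopology.SingularHomology.cupProduct (show 2 + 2 = 4 from rfl) σ σ) ≠ 0 ∧ ∀ τ : Literature.AlgebraicGeometry.HodgeTheory.complexBetti X 2, Literature.AlgebraicGeometry.HodgeTheory.IsOfHodgeType 6 X 2 2 0 τ → ∃ t : ℂ, τ = t • σ) ∧ (g 0 = CategoryTheory.CategoryStruct.id X ∧ (∀ a b : (Fin 8 → ZMod 2), g (a + b) = CategoryTheory.CategoryStruct.comp (g a) (g b)) ∧ (∀ a : (Fin 8 → ZMod 2), a ≠ 0 → g a ≠ CategoryTheory.CategoryStruct.id X) ∧ (∀ (a : (Fin 8 → ZMod 2)) (c : Literature.AlgebraicGeometry.HodgeTheory.complexBetti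 X 2), Literature.AlgebraicGeometry.HodgeTheory.complexBetti.map (g a) 2 c = c))) → ∀ a : (Fin 8 → ZMod 2), a ≠ 0 → (∀ c₄ : Literature.AlgebraicGeometry.HodgeTheory.complexBetti X (2 * 2), ((1 / 256 : ℂ) • ∑ b : (Fin 8 → ZMod 2), ((-1 : ℂ) ^ (∑ i : Fin 8, (a i * b i).val)) • Literature.AlgebraicGeometry.HodgeTheory.complexBetti.map (g b) (2 * 2) c₄) = 0) → (∀ c : Literature.AlgebraicGeometry.HodgeTheory.complexBetti X (2 * 3), Literature.AlgebraicGeometry.HodgeTheory.IsRationalClass c → Literature.AlgebraicGeometry.HodgeTheory.IsOfHodgeType 6 X (2 * 3) 3 3 c → ((1 / 256 : ℂ) • ∑ b : (Fin 8 → ZMod 2), ((-1 : ℂ) ^ (∑ i : Fin 8, (a i * b i).val)) • Literature.AlgebraicGeometry.HodgeTheory.complexBetti.map (g b) (2 * 3) c) ∈ Literature.AlgebraicGeometry.HodgeTheory.algebraicClasses X 3) ∧ (∀ c : Literature.AlgebraicGeometry.HodgeTheory.complexBetti X (2 * 4), Literature.AlgebraicGeometry.HodgeTheory.IsRationalClass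 c → Literature.AlgebraicGeometry.HodgeTheory.IsOfHodgeType 6 X (2 * 4) 4 4 c → ((1 / 256 : ℂ) • ∑ b : (Fin 8 → ZMod 2), ((-1 : ℂ) ^ (∑ i : Fin 8, (a i * b i).val)) • Literature.AlgebraicGeometry.HodgeTheory.complexBetti.map (g b) (2 * 4) c) ∈ Literature.AlgebraicGeometry.HodgeTheory.algebraicClasses X 4)

/-- item stmt-HodgeConjecture-8120 · crux · rank 3 · closed · moot by None · by planner
why it might fail: Fixed K3s feed H⁸ only; reaching the 135 H⁴-lines needs Lefschetz B for OG6-type in degree 4 (open: 1009.0413 is K3^[n]; 1002.5011, 2007.11872 degree 2) or fixed fourfolds; the 16-K3 permutation modules may miss characters; if G acts on V_(1,1,1) by ε≠1 this decl (no E=Q) holds CM classes (Λ²T)^Hdg.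
sources: arXiv:1411.0759, arXiv:1009.0413, arXiv:1002.5011, arXiv:2007.11872, arXiv:1906.03432, arXiv:2203.16257
[crux] EVEN CHARACTER STRINGS (card C2): for every OG6 frame (X, g) and every a ≠ 0 whose character
OCCURS on H⁴ (∃ c₄, e_a c₄ ≠ 0 — the card's 135 non-zero "even theta characteristics", one canonical
line u_a ∈ H⁴ each, with the V-string u_a·H² ⊂ H⁶ and u_a·h² ∈ H⁸), the e_a-projections of rational
(2,2)-, (3,3)- and (4,4)-classes are algebraic. Intended proof: e_a H⁸ is spanned by e_a[S] for the
fixed K3 surfaces S of the 30 pure involutions (arXiv:1411.0759 Props 5.1, 5.3; fixed loci deform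
with X), then invert L_h² (standard conjecture B for OG6-type in degrees 4 ↔ 8) or use fixed
fourfolds if the census finds them; H⁶ follows by cup with divisors. [difficulty: L] -/
@[route_item "route-HodgeConjecture-OG6ThetaCharacters"]
def EvenCharacterStrings : Prop :=
  ∀ (X : Literature.AlgebraicGeometry.Motives.SchemeOver ℂ) (g : (Fin 8 → ZMod 2) → (X ⟶ X)), (Literature.AlgebraicGeometry.Motives.IsSmoothProjective 6 X ∧ Nonempty (Literature.AlgebraicGeometry.HodgeTheory.HodgeModel 6 X) ∧ (Subsingleton (Literature.AlgebraicGeometry.HodgeTheory.complexBetti X 1) ∧ Subsingleton (Literature.AlgebraicGeometry.HodgeTheory.complexBetti X 3) ∧ Subsingleton (Literature.AlgebraicGeometry.HodgeTheory.complexBetti X 5)) ∧ (Module.finrank ℂ (Literature.AlgebraicGeometry.HodgeTheory.complexBetti X 2) = 8 ∧ Module.finrank ℂ (Literature.AlgebraicGeometry.HodgeTheory.complexBetti X 4) = 199 ∧ Module.finrank ℂ (Literature.AlgebraicGeometry.HodgeTheory.complexBetti X 6) = 1504) ∧ (∃ σ : Literature.AlgebraicGeometry.HodgeTheory.complexBetti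 X 2, Literature.AlgebraicGeometry.HodgeTheory.IsOfHodgeType 6 X 2 2 0 σ ∧ Literature.AlgebraicTopology.SingularHomology.cupProduct (show 2 + 4 = 6 from rfl) σ (Literature.AlgebraicTopology.SingularHomology.cupProduct (show 2 + 2 = 4 from rfl) σ σ) ≠ 0 ∧ ∀ τ : Literature.AlgebraicGeometry.HodgeTheory.complexBetti X 2, Literature.AlgebraicGeometry.HodgeTheory.IsOfHodgeType 6 X 2 2 0 τ → ∃ t : ℂ, τ = t • σ) ∧ (g 0 = CategoryTheory.CategoryStruct.id X ∧ (∀ a b : (Fin 8 → ZMod 2), g (a + b) = CategoryTheory.CategoryStruct.comp (g a) (g b)) ∧ (∀ a : (Fin 8 → ZMod 2), a ≠ 0 → g a ≠ CategoryTheory.CategoryStruct.id X) ∧ (∀ (a : (Fin 8 → ZMod 2)) (c : Literature.AlgebraicGeometry.HodgeTheory.complexBetti X 2), Literature.AlgebraicGeometry.HodgeTheory.complexBetti.map (g a) 2 c = c))) → ∀ a : (Fin 8 → ZMod 2), a ≠ 0 → (∃ c₄ : Literature.AlgebraicGeometry.HodgeTheory.complexBetti X (2 * 2), ((1 / 256 :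 ℂ) • ∑ b : (Fin 8 → ZMod 2), ((-1 : ℂ) ^ (∑ i : Fin 8, (a i * b i).val)) • Literature.AlgebraicGeometry.HodgeTheory.complexBetti.map (g b) (2 * 2) c₄) ≠ 0) → (∀ c : Literature.AlgebraicGeometry.HodgeTheory.complexBetti X (2 * 2), Literature.AlgebraicGeometry.HodgeTheory.IsRationalClass c → Literature.AlgebraicGeometry.HodgeTheory.IsOfHodgeType 6 X (2 * 2) 2 2 c → ((1 / 256 : ℂ) • ∑ b : (Fin 8 → ZMod 2), ((-1 : ℂ) ^ (∑ i : Fin 8, (a i * b i).val)) • Literature.AlgebraicGeometry.HodgeTheory.complexBetti.map (g b) (2 * 2) c) ∈ Literature.AlgebraicGeometry.HodgeTheory.algebraicClasses X 2) ∧ (∀ c : Literature.AlgebraicGeometry.HodgeTheory.complexBetti X (2 * 3), Literature.AlgebraicGeometry.HodgeTheory.IsRationalClass c → Literature.AlgebraicGeometry.HodgeTheory.IsOfHodgeType 6 X (2 * 3) 3 3 c → ((1 / 256 : ℂ) • ∑ b : (Fin 8 → ZMod 2), ((-1 : ℂ) ^ (∑ i : Fin 8, (a i * b i).val)) • Literature.AlgebraicGeometry.HodgeTheory.complexBetti.map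 (g b) (2 * 3) c) ∈ Literature.AlgebraicGeometry.HodgeTheory.algebraicClasses X 3) ∧ (∀ c : Literature.AlgebraicGeometry.HodgeTheory.complexBetti X (2 * 4), Literature.AlgebraicGeometry.HodgeTheory.IsRationalClass c → Literature.AlgebraicGeometry.HodgeTheory.IsOfHodgeType 6 X (2 * 4) 4 4 c → ((1 / 256 : ℂ) • ∑ b : (Fin 8 → ZMod 2), ((-1 : ℂ) ^ (∑ i : Fin 8, (a i * b i).val)) • Literature.AlgebraicGeometry.HodgeTheory.complexBetti.map (g b) (2 * 4) c) ∈ Literature.AlgebraicGeometry.HodgeTheory.algebraicClasses X 4)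

/-- item stmt-HodgeConjecture-8121 · crux · rank 4 · closed · moot by None · by planner
why it might fail: Rests on the unverified table (H*)^G = V_(3)⊕V_(1,1,1) (Lefschetz: dim(H*)^G = Σ_g χ(X^g)/256, printed census gives 72.2): a trivial character among the 135 V-copies/240 singlets imports exceptional classes; else q^∨ needs c₂ ∈ Sym²H², and d∧d′, h∧u₊∧u₋ have no known cycles off 2504.13607's divisor.
sources: arXiv:1906.03432, arXiv:1411.0759, arXiv:2203.16257, arXiv:2504.13607, arXiv:2210.02948, arXiv:2308.02267
[crux] INVARIANT SECTOR (card "A₂-part" made honest): for every endomorphism-generic OG6 frame (X,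
g) (E = Q) and every rational (p,p)-class c, the G-average e₀ c = 2⁻⁸ Σ_b g_b^* c is algebraic. By
the card's character table (H*)^G = V_(3) ⊕ V_(1,1,1): for E = Q its Hodge classes are polynomials
in NS(X) and the Beauville–Bogomolov class q^∨ (= c₂(X)/c if c₂ has no U₄-component) plus the
V_(1,1,1)-classes h∧u₊∧u₋ (ρ ≥ 1), d∧d′ ∈ Λ²NS ⊂ H⁴, H⁸ (ρ ≥ 2), Λ³NS (ρ ≥ 3) and det T ∈ Λ³T ⊂ H⁶
(ρ = 5). Natural engines: the associated K3^[3]-type double cover on the singular-OG6 divisor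
(arXiv:2504.13607, arXiv:1603.06731), quotients X/H for H ≤ G (Floccari's Y_K for Kum³,
arXiv:2210.02948), deformation of these classes from the modular locus (arXiv:2203.16257).
[difficulty: L] -/
@[route_item "route-HodgeConjecture-OG6ThetaCharacters"]
def InvariantSector : Prop :=
  ∀ (X : Literature.AlgebraicGeometry.Motives.SchemeOver ℂ) (g : (Fin 8 → ZMod 2) → (X ⟶ X)), (Literature.AlgebraicGeometry.Motives.IsSmoothProjective 6 X ∧ Nonempty (Literature.AlgebraicGeometry.HodgeTheory.HodgeModel 6 X) ∧ (Subsingleton (Literature.AlgebraicGeometry.HodgeTheory.complexBetti X 1) ∧ Subsingleton (Literature.AlgebraicGeometry.HodgeTheory.complexBetti X 3) ∧ Subsingleton (Literature.AlgebraicGeometry.HodgeTheory.complexBetti X 5)) ∧ (Module.finrank ℂ (Literature.AlgebraicGeometry.HodgeTheory.complexBetti X 2) = 8 ∧ Module.finrank ℂ (Literature.AlgebraicGeometry.HodgeTheory.complexBetti X 4) = 199 ∧ Module.finrank ℂ (Literature.AlgebraicGeometry.HodgeTheory.complexBetti X 6) = 1504) ∧ (∃ σ : Literature.AlgebraicGeometry.HodgeTheory.complexBetti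 X 2, Literature.AlgebraicGeometry.HodgeTheory.IsOfHodgeType 6 X 2 2 0 σ ∧ Literature.AlgebraicTopology.SingularHomology.cupProduct (show 2 + 4 = 6 from rfl) σ (Literature.AlgebraicTopology.SingularHomology.cupProduct (show 2 + 2 = 4 from rfl) σ σ) ≠ 0 ∧ ∀ τ : Literature.AlgebraicGeometry.HodgeTheory.complexBetti X 2, Literature.AlgebraicGeometry.HodgeTheory.IsOfHodgeType 6 X 2 2 0 τ → ∃ t : ℂ, τ = t • σ) ∧ (g 0 = CategoryTheory.CategoryStruct.id X ∧ (∀ a b : (Fin 8 → ZMod 2), g (a + b) = CategoryTheory.CategoryStruct.comp (g a) (g b)) ∧ (∀ a : (Fin 8 → ZMod 2), a ≠ 0 → g a ≠ CategoryTheory.CategoryStruct.id X) ∧ (∀ (a : (Fin 8 → ZMod 2)) (c : Literature.AlgebraicGeometry.HodgeTheory.complexBetti X 2), Literature.AlgebraicGeometry.HodgeTheory.complexBetti.map (g a) 2 c = c))) → (∀ ψ : Literature.AlgebraicGeometry.HodgeTheory.complexBetti X 2 →ₗ[ℂ] Literature.AlgebraicGeometry.HodgeTheory.complexBetti X 2,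 (∀ c, Literature.AlgebraicGeometry.HodgeTheory.IsRationalClass c → Literature.AlgebraicGeometry.HodgeTheory.IsRationalClass (ψ c)) → (∀ (p q : ℕ) (c : Literature.AlgebraicGeometry.HodgeTheory.complexBetti X 2), Literature.AlgebraicGeometry.HodgeTheory.IsOfHodgeType 6 X 2 p q c → Literature.AlgebraicGeometry.HodgeTheory.IsOfHodgeType 6 X 2 p q (ψ c)) → ∃ r : ℚ, ∀ σ : Literature.AlgebraicGeometry.HodgeTheory.complexBetti X 2, Literature.AlgebraicGeometry.HodgeTheory.IsOfHodgeType 6 X 2 2 0 σ → ψ σ = (r : ℂ) • σ) → ∀ (p : ℕ) (c : Literature.AlgebraicGeometry.HodgeTheory.complexBetti X (2 * p)), Literature.AlgebraicGeometry.HodgeTheory.IsRationalClass c → Literature.AlgebraicGeometry.HodgeTheory.IsOfHodgeType 6 X (2 * p) p p c → ((1 / 256 : ℂ) • ∑ b : (Fin 8 → ZMod 2), ((-1 : ℂ) ^ (∑ i : Fin 8, ((0 : (Fin 8 → ZMod 2)) i * b i).val)) • Literature.AlgebraicGeometry.HodgeTheory.complexBetti.map (g b) (2 * p) c) ∈ Literature.AlgebraicGeometry.HodgeTheory.algebraicClasses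 X p

/-- item stmt-HodgeConjecture-8122 · support · rank 9 · closed · moot by None · by planner
sources: arXiv:1411.0759, Deligne2000
[support] BOOKKEEPING: for an OG6 frame, p ∉ {2,3,4} and a ≠ 0, the e_a-projection of a rational
(p,p)-class in H^(2p) is algebraic — indeed it vanishes: H⁰ and H² are G-trivial by hypothesis (and
algebraicClasses X 0 = ⊤ is proved), H¹⁰, H¹² by hard Lefschetz with a G-invariant ample class /
Poincaré duality and naturality of cup product (`cupProduct_map`, proved), H^(2p) = 0 for p ≥ 7
(cohomological dimension of the 12-manifold X(ℂ)); needs the named facts hard Lefschetz / top-degree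
vanishing for X. [difficulty: provable-now] -/
@[route_item "route-HodgeConjecture-OG6ThetaCharacters"]
def OuterDegrees : Prop :=
  ∀ (X : Literature.AlgebraicGeometry.Motives.SchemeOver ℂ) (g : (Fin 8 → ZMod 2) → (X ⟶ X)), (Literature.AlgebraicGeometry.Motives.IsSmoothProjective 6 X ∧ Nonempty (Literature.AlgebraicGeometry.HodgeTheory.HodgeModel 6 X) ∧ (Subsingleton (Literature.AlgebraicGeometry.HodgeTheory.complexBetti X 1) ∧ Subsingleton (Literature.AlgebraicGeometry.HodgeTheory.complexBetti X 3) ∧ Subsingleton (Literature.AlgebraicGeometry.HodgeTheory.complexBetti X 5)) ∧ (Module.finrank ℂ (Literature.AlgebraicGeometry.HodgeTheory.complexBetti X 2) = 8 ∧ Module.finrank ℂ (Literature.AlgebraicGeometry.HodgeTheory.complexBetti X 4) = 199 ∧ Module.finrank ℂ (Literature.AlgebraicGeometry.HodgeTheory.complexBetti X 6) = 1504) ∧ (∃ σ : Literature.AlgebraicGeometry.HodgeTheory.complexBetti X 2, Literature.AlgebraicGeometry.HodgeTheory.IsOfHodgeType 6 X 2 2 0 σ ∧ Literature.AlgebraicTopology.SingularHomology.cupProduct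 (show 2 + 4 = 6 from rfl) σ (Literature.AlgebraicTopology.SingularHomology.cupProduct (show 2 + 2 = 4 from rfl) σ σ) ≠ 0 ∧ ∀ τ : Literature.AlgebraicGeometry.HodgeTheory.complexBetti X 2, Literature.AlgebraicGeometry.HodgeTheory.IsOfHodgeType 6 X 2 2 0 τ → ∃ t : ℂ, τ = t • σ) ∧ (g 0 = CategoryTheory.CategoryStruct.id X ∧ (∀ a b : (Fin 8 → ZMod 2), g (a + b) = CategoryTheory.CategoryStruct.comp (g a) (g b)) ∧ (∀ a : (Fin 8 → ZMod 2), a ≠ 0 → g a ≠ CategoryTheory.CategoryStruct.id X) ∧ (∀ (a : (Fin 8 → ZMod 2)) (c : Literature.AlgebraicGeometry.HodgeTheory.complexBetti X 2), Literature.AlgebraicGeometry.HodgeTheory.complexBetti.map (g a) 2 c = c))) → ∀ p : ℕ, p ≠ 2 → p ≠ 3 → p ≠ 4 → ∀ a : (Fin 8 → ZMod 2), a ≠ 0 → ∀ c : Literature.AlgebraicGeometry.HodgeTheory.complexBetti X (2 * p), Literature.AlgebraicGeometry.HodgeTheory.IsRationalClass c → Literature.AlgebraicGeometry.HodgeTheory.IsOfHodgeType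 6 X (2 * p) p p c → ((1 / 256 : ℂ) • ∑ b : (Fin 8 → ZMod 2), ((-1 : ℂ) ^ (∑ i : Fin 8, (a i * b i).val)) • Literature.AlgebraicGeometry.HodgeTheory.complexBetti.map (g b) (2 * p) c) ∈ Literature.AlgebraicGeometry.HodgeTheory.algebraicClasses X p

/-- item stmt-HodgeConjecture-8123 · support · rank 9 · closed · moot by None · by planner
sources: arXiv:1411.0759
[support] CHARACTER ORTHOGONALITY: for an OG6 frame, Σ_a e_a c = c on every H^k — from g 0 = 𝟙,
`complexBetti.map_id` (proved) and Σ_a (−1)^(a·b) = 256·[b = 0] on (Fin 8 → ZMod 2) (factorise over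
coordinates). Pure algebra. [difficulty: provable-now] -/
@[route_item "route-HodgeConjecture-OG6ThetaCharacters"]
def FourierInversion : Prop :=
  ∀ (X : Literature.AlgebraicGeometry.Motives.SchemeOver ℂ) (g : (Fin 8 → ZMod 2) → (X ⟶ X)), (Literature.AlgebraicGeometry.Motives.IsSmoothProjective 6 X ∧ Nonempty (Literature.AlgebraicGeometry.HodgeTheory.HodgeModel 6 X) ∧ (Subsingleton (Literature.AlgebraicGeometry.HodgeTheory.complexBetti X 1) ∧ Subsingleton (Literature.AlgebraicGeometry.HodgeTheory.complexBetti X 3) ∧ Subsingleton (Literature.AlgebraicGeometry.HodgeTheory.complexBetti X 5)) ∧ (Module.finrank ℂ (Literature.AlgebraicGeometry.HodgeTheory.complexBetti X 2) = 8 ∧ Module.finrank ℂ (Literature.AlgebraicGeometry.HodgeTheory.complexBetti X 4) = 199 ∧ Module.finrank ℂ (Literature.AlgebraicGeometry.HodgeTheory.complexBetti X 6) = 1504) ∧ (∃ σ : Literature.AlgebraicGeometry.HodgeTheory.complexBetti X 2, Literature.AlgebraicGeometry.HodgeTheory.IsOfHodgeType 6 X 2 2 0 σ ∧ Literature.AlgebraicTopology.SingularHomology.cupProduct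 (show 2 + 4 = 6 from rfl) σ (Literature.AlgebraicTopology.SingularHomology.cupProduct (show 2 + 2 = 4 from rfl) σ σ) ≠ 0 ∧ ∀ τ : Literature.AlgebraicGeometry.HodgeTheory.complexBetti X 2, Literature.AlgebraicGeometry.HodgeTheory.IsOfHodgeType 6 X 2 2 0 τ → ∃ t : ℂ, τ = t • σ) ∧ (g 0 = CategoryTheory.CategoryStruct.id X ∧ (∀ a b : (Fin 8 → ZMod 2), g (a + b) = CategoryTheory.CategoryStruct.comp (g a) (g b)) ∧ (∀ a : (Fin 8 → ZMod 2), a ≠ 0 → g a ≠ CategoryTheory.CategoryStruct.id X) ∧ (∀ (a : (Fin 8 → ZMod 2)) (c : Literature.AlgebraicGeometry.HodgeTheory.complexBetti X 2), Literature.AlgebraicGeometry.HodgeTheory.complexBetti.map (g a) 2 c = c))) → ∀ (k : ℕ) (c : Literature.AlgebraicGeometry.HodgeTheory.complexBetti X k), ∑ a : (Fin 8 → ZMod 2), ((1 / 256 : ℂ) • ∑ b : (Fin 8 → ZMod 2), ((-1 : ℂ) ^ (∑ i : Fin 8, (a i * b i).val)) • Literature.AlgebraicGeometry.HodgeTheory.complexBetti.map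 (g b) k c) = c

/-- item stmt-HodgeConjecture-8212 · support · rank 9 · closed · moot by None · by planner
[support] FRAME: the summit statement implies X (an OG6 frame is in particular a smooth projective
sixfold over C): records that X = Target is an instance family of HodgeConjecture (regime route; X
-> HodgeConjecture is of course not claimed). PROVED in the planner's Sketch.lean (theorem
targetOfHodgeConjecture_holds: fun hHC X g hF _ => hHC hF.1); a prover can land it verbatim in
Theorems/. Target written fully qualified only to keep the ledger signature distinct from
EvenB2Twistor's homonymous frame item. [difficulty: provable-now] Sources: Deligne2000 -/
@[route_item "route-HodgeConjecture-OG6ThetaCharacters"]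
def TargetOfHodgeConjecture : Prop :=
  HodgeConjecture → Summit.HodgeConjecture.HodgeConjecture.Theses.OG6ThetaCharacters.Target

-- item stmt-HodgeConjecture-8213 · support · rank 9 · closed · moot by None · by planner — informal only, no Lean statement yet:
--   [support] CHARACTER CENSUS OF OG6 (card S1; the route's cheapest falsifier and the prerequisite of
--   every layer-2 split). For a manifold X of OG6 type with G = Aut_0(X) = ker(Aut X -> O(H^2)) =
--   (Z/2)^8 (arXiv:1411.0759 Thm 4.2), determine (a) the G-character of H^4, H^6, H^8 (multiplicity of
--   each of the 256 characters, and which LLV summands of arXiv:1906.03432 Thm 52 — V_(3), V_(1,1,1),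
--   the 135-dim multiplicity space of V, the 240-dim multiplicity space of the trivial module — they
--   occupy) and (b) the fixed locus X^g of each of the 255 involutions (dimensions and types of
--   components). Both are

-- item stmt-HodgeConjecture-8214 · support · rank 9 · closed · moot by None · by planner — informal only, no Lean statement yet:
--   [support] FRAME OF OG6 TYPE (bridge from the typed Target to the deformation type; informal until
--   IsOfOGradySixType is defined — definition request filed). Every projective manifold X of OG6 type
--   (deformation equivalent to O'Grady's crepant resolution K~_v(A,H)) satisfies the route's typed frame
--   with g an isomorphism (Z/2)^8 -> Aut_0(X): X is smooth projective of dimension 6 with a Hodge model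
--   (GAGA/Hodge theory); b_1 = b_3 = b_5 = 0, b_2 = 8, b_4 = 199, b_6 = 1504 (arXiv:1603.06731,
--   Rapagnetta Math. Z. 256 (2007)); H^{2,0} = C sigma with sigma^3 != 0 in H^6(X(C);C) (irreducible
--   holomorphic sy

/-- item stmt-HodgeConjecture-8124 · assembly · rank 1 · closed · moot by None · by planner
sources: arXiv:2308.02267, Deligne2000
[assembly] ChiralThreefolds → EvenCharacterStrings → InvariantSector → OuterDegrees →
FourierInversion → Target. -/
@[route_item "route-HodgeConjecture-OG6ThetaCharacters"]
def Assembly : Prop :=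
  ChiralThreefolds → EvenCharacterStrings → InvariantSector → OuterDegrees → FourierInversion → Target

end Summit.HodgeConjecture.HodgeConjecture.Theses.OG6ThetaCharacters
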